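import Mathlib
import HarnessLib
import Summits.HubbardSuperconductivity.HubbardSuperconductivity.Theorems.KLProgrammePolarRayCoarea
import Summits.HubbardSuperconductivity.HubbardSuperconductivity.Theorems.KLProgrammePerturbedFermiCurveDefs
import Summits.HubbardSuperconductivity.HubbardSuperconductivity.Theorems.KLProgrammeH10TwoPointLimitPerturbedFermiRadiusSmooth

/-!
# Route `KLProgramme` — crux K3 split, ENGINE child (`KLRegimeEngineV11` stmt-HubbardSuperconductivity-19823; gen-2 `…V7` 19662):
# the polar-ray / level coordinates ON THE FRAME'S CURVE — `∫ d²k` over the tube `|ε₀(k) + δ(k) − μ| < ē` of the PERTURBED band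
# `E = ε₀ + δ` (the counterterm frame `e_K = ε₀ − μ − K` is `δ = −K`) as `∫ dθ ∫ de 𝒥_E(θ,e) h(u_E(μ+e,θ)·dir θ)`, with p4's radial graph
# `u_E = perturbedFermiRadius δ` and the Jacobian `𝒥_E(θ,e) = u_E/∂_tG(θ,u_E)`, `∂_tG = ∂_tε₀ + Dδ[dir θ]`
# (cell gate-hubbard-kl, seat hubbard-kl-k3c2-p2 «thermal-bar induction n ≤ nScales β + 1»)

`…PolarRayCoarea` is abstract in the ray reparametrisation; `…PolarRayCoareaBand` is the bare band.  Here the LEVEL REGULARITY of the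
perturbed Fermi radius that the abstract theorem consumes is PROVED from p4's order-zero theory (`…H10TwoPointLimitPerturbedFermiRadius`,
`…PerturbedFermiCurveDefs`, `…PerturbedFermiRadiusSmooth`: existence, level shift, uniqueness under `‖Dδ‖ ≤ κ₁ < Dt_min`, `∂_tG > 0`):
* §1 growth of the perturbed ray dispersion `G(θ,t) = ε₀(t·dir θ) + δ(t·dir θ)` with the floor `Dt_min − κ₁` between two points of the
  ray whose free levels lie in the sub-band `[a, b]` (`klrf_growth`);
* §2 the perturbed radius as a function of the LEVEL: monotone and `(Dt_min − κ₁)⁻¹`-Lipschitz (`klrf_level_mono`, `klrf_level_lipschitz`),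
  hence continuous; its level derivative `∂_ν u_E(ν,θ) = 1/∂_tG(θ, u_E)` (`klrf_hasDerivAt_level`, inverse-function rule
  `HasDerivAt.of_local_left_inverse`); continuity of the Jacobian factor on `[−ē, ē]`;
* §3 the ray support of a tube-supported `h` (`klrf_ray_support`) and the COAREA on the frame's curve (`klrf_integral_eq_frame_level_coords`,
  `_radial`): for `h : ℝ × ℝ → E` continuous, compactly supported, supported in the open square and in `|ε₀ + δ − μ| < ē`,
  `∫ h = ∫_{θ ∈ (−π,π)} ∫_{e ∈ −ē..ē} (u_E(μ+e,θ)·(∂_tG(θ,u_E(μ+e,θ)))⁻¹) • h(u_E(μ+e,θ) cos θ, u_E(μ+e,θ) sin θ) de dθ`.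
Hypotheses (p4's): `B : BandBounds a b`, `δ ∈ C¹` with `|δ| ≤ κ₀`, `‖Dδ‖ ≤ κ₁` on the closed square, `κ₁ < Dt_min`, and the level window with
margin `a < μ − ē − κ₀`, `μ + ē + κ₀ < b` (strict, so that level derivatives exist at the end points).  Pure analysis on the tree's objects.
References: BGM 2006 §2.4 Lemma 2.1, §2.5 (2.56b)–(2.56e); HOME/p1/E2-NOTE.md §1; HOME/prover-p4/INVERSION-NOTE.md §2.
-/

noncomputable section

namespace Summit.HubbardSuperconductivity.HubbardSuperconductivity.Theorems.KLRegimeSplit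

set_option linter.dupNamespace false -- summit = problem name (single-conjunct summit), D-0017

open Real Set Filter MeasureTheory intervalIntegral Literature.MathematicalPhysics.QuantumLattice
open Literature.MathematicalPhysics.QuantumLattice.BandSectorCounting
open Summit.HubbardSuperconductivity.HubbardSuperconductivity.Theorems.PerturbedFermiCurve
open scoped Topology

section Frame

variable {a b : ℝ} (B : BandBounds a b) {δ : (Fin 2 → ℝ) → ℝ} (hδ1 : ContDiff ℝ 1 δ) {κ₀ κ₁ : ℝ}
  (hδ : ∀ k : Fin 2 → ℝ, (∀ i, |k i| ≤ π) → |δ k| ≤ κ₀)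
  (hκ : ∀ k : Fin 2 → ℝ, (∀ i, |k i| ≤ π) → ‖fderiv ℝ δ k‖ ≤ κ₁) (hκ₁ : κ₁ < B.Dtmin)

/-! ## §1 Growth of the perturbed ray dispersion -/

include hδ1 hκ in
/-- The radial Lipschitz bound of `δ` on every ray segment of the closed square (p4's `radialLipschitz_of_fderiv_le`, `δ ∈ C¹`). -/
theorem klrf_radialLipschitz (θ : ℝ) :
    ∀ s t : ℝ, s ∈ Icc 0 (π / ‖dir θ‖) → t ∈ Icc 0 (π / ‖dir θ‖) → |δ (s • dir θ) - δ (t • dir θ)| ≤ κ₁ * |s - t| :=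
  radialLipschitz_of_fderiv_le (fun k _ => (hδ1.differentiable one_ne_zero) k) hκ θ

include B hδ1 hκ in
/-- **Growth with the floor `Dt_min − κ₁`**: for `0 ≤ t₁ ≤ t₂` on the ray segment (`t₂‖dir θ‖ ≤ π`) whose FREE levels lie in `[a, b]`,
`(Dt_min − κ₁)(t₂ − t₁) ≤ G(θ,t₂) − G(θ,t₁)`, `G(θ,t) = ε₀(t·dir θ) + δ(t·dir θ)`. -/
theorem klrf_growth {θ t₁ t₂ : ℝ} (h0 : 0 ≤ t₁) (h12 : t₁ ≤ t₂) (h2 : t₂ * ‖dir θ‖ ≤ π)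
    (ha : a ≤ rayDispersion (θ, t₁)) (hb : rayDispersion (θ, t₂) ≤ b) :
    (B.Dtmin - κ₁) * (t₂ - t₁) ≤
      (rayDispersion (θ, t₂) + δ (t₂ • dir θ)) - (rayDispersion (θ, t₁) + δ (t₁ • dir θ)) := by
  have hn := norm_dir_pos θ
  have h1 := Dtmin_mul_sub_le_rayDispersion_sub B h0 h12 h2 ha hb
  have ht₁I : t₁ ∈ Icc 0 (π / ‖dir θ‖) :=
    ⟨h0, by rw [le_div_iff₀ hn]; exact (mul_le_mul_of_nonneg_right h12 hn.le).trans h2⟩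
  have ht₂I : t₂ ∈ Icc 0 (π / ‖dir θ‖) := ⟨h0.trans h12, by rwa [le_div_iff₀ hn]⟩
  have h3 := klrf_radialLipschitz hδ1 hκ θ t₂ t₁ ht₂I ht₁I
  rw [abs_of_nonneg (sub_nonneg.mpr h12)] at h3
  have h4 := (abs_le.mp h3).1
  nlinarith

/-! ## §2 The perturbed Fermi radius as a function of the level -/

include B hδ1 hδ hκ hκ₁ in
/-- **Monotone in the level with a Lipschitz modulus**: for admissible levels `ν ≤ ν'` (`a ≤ ν − κ₀`, `ν' + κ₀ ≤ b`),
`u_E(ν,θ) ≤ u_E(ν',θ)` and `(Dt_min − κ₁)(u_E(ν',θ) − u_E(ν,θ)) ≤ ν' − ν`. -/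
theorem klrf_level_mono_growth {ν ν' : ℝ} (hν : a ≤ ν - κ₀) (hν' : ν' + κ₀ ≤ b) (hνν' : ν ≤ ν') (θ : ℝ) :
    perturbedFermiRadius δ ν θ ≤ perturbedFermiRadius δ ν' θ ∧
      (B.Dtmin - κ₁) * (perturbedFermiRadius δ ν' θ - perturbedFermiRadius δ ν θ) ≤ ν' - ν := by
  have hδc : Continuous δ := hδ1.continuous
  have hκ₀ : 0 ≤ κ₀ := (abs_nonneg _).trans (hδ 0 (fun i => by simp [Real.pi_pos.le]))
  have hνhi : ν + κ₀ ≤ b := by linarith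
  have hν'lo : a ≤ ν' - κ₀ := by linarith
  set u := perturbedFermiRadius δ ν θ with hu
  set u' := perturbedFermiRadius δ ν' θ with hu'
  have hR : IsBandFermiRadius (ν - δ (u • dir θ)) θ u := isBandFermiRadius_perturbedFermiRadius B hδc hδ hν hνhi θ
  have hR' : IsBandFermiRadius (ν' - δ (u' • dir θ)) θ u' := isBandFermiRadius_perturbedFermiRadius B hδc hδ hν'lo hν' θ
  have hm := shiftedLevel_perturbedFermiRadius_mem_Icc B hδc hδ hν hνhi θ
  have hm' := shiftedLevel_perturbedFermiRadius_mem_Icc B hδc hδ hν'lo hν' θ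
  have hG : rayDispersion (θ, u) + δ (u • dir θ) = ν := by have := hR.2; linarith
  have hG' : rayDispersion (θ, u') + δ (u' • dir θ) = ν' := by have := hR'.2; linarith
  have hDt : 0 < B.Dtmin - κ₁ := by linarith
  -- monotonicity: `u' < u` is impossible
  have hle : u ≤ u' := by
    by_contra hlt
    push Not at hlt
    have hg := klrf_growth B hδ1 hκ hR'.1.1 hlt.le hR.1.2 (by rw [hR'.2]; exact hm'.1) (by rw [hR.2]; exact hm.2)
    rw [hG, hG'] at hg
    nlinarith
  refine ⟨hle, ?_⟩
  have hg := klrf_growth B hδ1 hκ hR.1.1 hle hR'.1.2 (by rw [hR.2]; exact hm.1) (by rw [hR'.2]; exact hm'.2)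
  rw [hG, hG'] at hg
  exact hg

include B hδ1 hδ hκ hκ₁ in
/-- **Lipschitz in the level**: `|u_E(ν',θ) − u_E(ν,θ)| ≤ |ν' − ν|/(Dt_min − κ₁)` for admissible `ν, ν'`. -/
theorem klrf_level_lipschitz {ν ν' : ℝ} (hν : a ≤ ν - κ₀) (hνb : ν + κ₀ ≤ b) (hν'a : a ≤ ν' - κ₀) (hν' : ν' + κ₀ ≤ b) (θ : ℝ) :
    |perturbedFermiRadius δ ν' θ - perturbedFermiRadius δ ν θ| ≤ |ν' - ν| / (B.Dtmin - κ₁) := by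
  have hDt : 0 < B.Dtmin - κ₁ := by linarith
  rw [le_div_iff₀ hDt]
  rcases le_total ν ν' with h | h
  · obtain ⟨hle, hg⟩ := klrf_level_mono_growth B hδ1 hδ hκ hκ₁ hν hν' h θ
    rw [abs_of_nonneg (sub_nonneg.mpr hle), abs_of_nonneg (sub_nonneg.mpr h)]
    linarith
  · obtain ⟨hle, hg⟩ := klrf_level_mono_growth B hδ1 hδ hκ hκ₁ hν'a hνb h θ
    rw [abs_of_nonpos (sub_nonpos.mpr hle), abs_of_nonpos (sub_nonpos.mpr h)]
    linarith

include B hδ1 hδ hκ hκ₁ in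
/-- Continuity in the level at an interior admissible level (`a < ν − κ₀`, `ν + κ₀ < b`). -/
theorem klrf_continuousAt_level {ν : ℝ} (hν : a < ν - κ₀) (hν' : ν + κ₀ < b) (θ : ℝ) :
    ContinuousAt (fun ν : ℝ => perturbedFermiRadius δ ν θ) ν := by
  have hDt : 0 < B.Dtmin - κ₁ := by linarith
  rw [Metric.continuousAt_iff]
  intro ε hε
  -- radius of admissibility around `ν`
  set r := min (ν - κ₀ - a) (b - (ν + κ₀)) with hr
  have hr0 : 0 < r := lt_min (by linarith) (by linarith)
  refine ⟨min r (ε * (B.Dtmin - κ₁) / 2), lt_min hr0 (by positivity), fun ν' hν'd => ?_⟩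
  have hd := lt_min_iff.mp hν'd
  rw [Real.dist_eq] at hd ⊢
  have h1 : |ν' - ν| < r := hd.1
  have hν'a : a ≤ ν' - κ₀ := by
    have := (abs_lt.mp h1).1; have := min_le_left (ν - κ₀ - a) (b - (ν + κ₀)); linarith
  have hν'b : ν' + κ₀ ≤ b := by
    have := (abs_lt.mp h1).2; have := min_le_right (ν - κ₀ - a) (b - (ν + κ₀)); linarith
  have hL := klrf_level_lipschitz B hδ1 hδ hκ hκ₁ hν.le hν'.le hν'a hν'b θ
  calc |perturbedFermiRadius δ ν' θ - perturbedFermiRadius δ ν θ| ≤ |ν' - ν| / (B.Dtmin - κ₁) := hL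
    _ < (ε * (B.Dtmin - κ₁) / 2) / (B.Dtmin - κ₁) := div_lt_div_of_pos_right hd.2 hDt
    _ = ε / 2 := by field_simp
    _ < ε := by linarith

include B hδ hκ in
/-- `∂_tG(θ, u_E(ν,θ)) ≥ Dt_min − κ₁` at an admissible level. -/
theorem klrf_pertDt_ge {ν : ℝ} (hδc : Continuous δ) (hν : a ≤ ν - κ₀) (hν' : ν + κ₀ ≤ b) (θ : ℝ) :
    B.Dtmin - κ₁ ≤ rayDispersionDt θ (perturbedFermiRadius δ ν θ) +
      fderiv ℝ δ (perturbedFermiRadius δ ν θ • dir θ) (dir θ) := by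
  have h1 := Dtmin_le_rayDispersionDt_perturbedFermiRadius B hδc hδ hν hν' θ
  have h2 := (abs_le.mp (abs_fderiv_dir_le (hκ _ (fun i => (abs_perturbedFermiRadius_smul_dir_lt B hδc hδ hν hν' θ i).le)) θ)).1
  linarith

include B hδ1 hδ hκ hκ₁ in
/-- **The level derivative of the perturbed Fermi radius** (inverse-function rule): at an interior admissible level,
`∂_ν u_E(ν,θ) = (∂_tε₀(θ,u) + Dδ(u·dir θ)[dir θ])⁻¹`, `u = u_E(ν,θ)`. -/
theorem klrf_hasDerivAt_level {ν : ℝ} (hν : a < ν - κ₀) (hν' : ν + κ₀ < b) (θ : ℝ) :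
    HasDerivAt (fun ν : ℝ => perturbedFermiRadius δ ν θ)
      (rayDispersionDt θ (perturbedFermiRadius δ ν θ) + fderiv ℝ δ (perturbedFermiRadius δ ν θ • dir θ) (dir θ))⁻¹ ν := by
  have hδc : Continuous δ := hδ1.continuous
  have hg : ContinuousAt (fun ν : ℝ => perturbedFermiRadius δ ν θ) ν := klrf_continuousAt_level B hδ1 hδ hκ hκ₁ hν hν' θ
  have hf : HasDerivAt (fun s : ℝ => rayDispersion (θ, s) + δ (s • dir θ))
      (rayDispersionDt θ (perturbedFermiRadius δ ν θ) + fderiv ℝ δ (perturbedFermiRadius δ ν θ • dir θ) (dir θ))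
      (perturbedFermiRadius δ ν θ) :=
    hasDerivAt_pertLevel_radius ((hδ1.differentiable one_ne_zero) _)
  have hf' : rayDispersionDt θ (perturbedFermiRadius δ ν θ) + fderiv ℝ δ (perturbedFermiRadius δ ν θ • dir θ) (dir θ) ≠ 0 := by
    have := klrf_pertDt_ge B hδ hκ hδc hν.le hν'.le θ
    have hDt : 0 < B.Dtmin - κ₁ := by linarith
    linarith
  -- near `ν` every level is admissible, so `G(θ, u_E(ν',θ)) = ν'`
  have hU : ∀ᶠ ν' : ℝ in 𝓝 ν, a < ν' - κ₀ ∧ ν' + κ₀ < b := by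
    have h1 : ∀ᶠ ν' : ℝ in 𝓝 ν, a + κ₀ < ν' := (isOpen_Ioi.mem_nhds (by linarith : a + κ₀ < ν))
    have h2 : ∀ᶠ ν' : ℝ in 𝓝 ν, ν' < b - κ₀ := (isOpen_Iio.mem_nhds (by linarith : ν < b - κ₀))
    filter_upwards [h1, h2] with ν' h1' h2'
    exact ⟨by linarith, by linarith⟩
  have hfg : ∀ᶠ ν' : ℝ in 𝓝 ν, rayDispersion (θ, perturbedFermiRadius δ ν' θ) + δ (perturbedFermiRadius δ ν' θ • dir θ) = ν' := by
    filter_upwards [hU] with ν' hν'U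
    have := (isBandFermiRadius_perturbedFermiRadius B hδc hδ hν'U.1.le hν'U.2.le θ).2
    linarith
  exact HasDerivAt.of_local_left_inverse hg hf hf' hfg

include B hδ1 hδ hκ hκ₁ in
/-- Continuity of the Jacobian factor `e ↦ (∂_tG(θ, u_E(μ+e,θ)))⁻¹` on `[−ē, ē]` (window with margin). -/
theorem klrf_continuousOn_invPertDt {μ ē : ℝ} (hlo : a < μ - ē - κ₀) (hhi : μ + ē + κ₀ < b) (θ : ℝ) :
    ContinuousOn (fun e : ℝ => (rayDispersionDt θ (perturbedFermiRadius δ (μ + e) θ) +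
      fderiv ℝ δ (perturbedFermiRadius δ (μ + e) θ • dir θ) (dir θ))⁻¹) (Icc (-ē) ē) := by
  have hδc : Continuous δ := hδ1.continuous
  -- `t ↦ ∂_tG(θ,t)` is continuous
  have hDtc : Continuous fun t : ℝ => rayDispersionDt θ t + fderiv ℝ δ (t • dir θ) (dir θ) := by
    have h1 : Continuous fun t : ℝ => rayDispersionDt θ t := by unfold rayDispersionDt; fun_prop
    have hF : Continuous (fderiv ℝ δ) := hδ1.continuous_fderiv one_ne_zero
    have hsm : Continuous fun t : ℝ => t • dir θ := continuous_id.smul continuous_const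
    have h2 : Continuous fun t : ℝ => fderiv ℝ δ (t • dir θ) (dir θ) := (hF.comp hsm).clm_apply continuous_const
    exact h1.add h2
  -- `e ↦ u_E(μ+e,θ)` is continuous on the window
  have huc : ∀ e ∈ Icc (-ē) ē, ContinuousAt (fun e : ℝ => perturbedFermiRadius δ (μ + e) θ) e := by
    intro e he
    have hA : ContinuousAt (fun ν : ℝ => perturbedFermiRadius δ ν θ) (μ + e) :=
      klrf_continuousAt_level B hδ1 hδ hκ hκ₁ (by linarith [he.1]) (by linarith [he.2]) θ
    have hB : Continuous (fun e : ℝ => μ + e) := by fun_prop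
    exact ContinuousAt.comp (f := fun e : ℝ => μ + e) (x := e) hA hB.continuousAt
  have hu_on : ContinuousOn (fun e : ℝ => perturbedFermiRadius δ (μ + e) θ) (Icc (-ē) ē) :=
    fun e he => (huc e he).continuousWithinAt
  have hcomp := hDtc.comp_continuousOn hu_on
  refine (hcomp.inv₀ ?_).congr (fun e _ => rfl)
  intro e he
  have := klrf_pertDt_ge B hδ hκ hδc (ν := μ + e) (by linarith [he.1]) (by linarith [he.2]) θ
  have hDt : 0 < B.Dtmin - κ₁ := by linarith
  simp only [Function.comp_apply]
  linarith

/-! ## §3 The coarea on the frame's curve -/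

omit B in
/-- Along a ray, the Cartesian point `(t cos θ, t sin θ)` as a `Fin 2`-vector is `t·dir θ`. -/
theorem klrf_vec_ray (θ t : ℝ) : (![t * Real.cos θ, t * Real.sin θ] : Fin 2 → ℝ) = t • dir θ := by
  ext i
  fin_cases i <;> simp [dir, smul_eq_mul]

include B hδ1 hδ hκ hκ₁ in
/-- **Ray support from tube support, perturbed band**: if `h` lives in the open square and in the tube `|ε₀ + δ − μ| < ē` with the margin
window `a < μ − ē − κ₀`, `μ + ē + κ₀ < b`, then along the ray of angle `θ` it vanishes outside
`t ∈ (u_E(μ−ē,θ), u_E(μ+ē,θ))`. -/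
theorem klrf_ray_support {E' : Type*} {h : ℝ × ℝ → E'} [Zero E'] {μ ē : ℝ} (hlo : a < μ - ē - κ₀) (hhi : μ + ē + κ₀ < b)
    (hsupp : ∀ p : ℝ × ℝ, h p ≠ 0 → |p.1| < π ∧ |p.2| < π ∧ |sqDispersion ![p.1, p.2] + δ ![p.1, p.2] - μ| < ē)
    {θ t : ℝ} (ht : 0 < t)
    (hnot : t ∉ Ioo (perturbedFermiRadius δ (μ - ē) θ) (perturbedFermiRadius δ (μ + ē) θ)) :
    h (t * Real.cos θ, t * Real.sin θ) = 0 := by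
  have hδc : Continuous δ := hδ1.continuous
  have hκ₀ : 0 ≤ κ₀ := (abs_nonneg _).trans (hδ 0 (fun i => by simp [Real.pi_pos.le]))
  by_contra hne
  obtain ⟨h1, h2, h3⟩ := hsupp _ hne
  rw [klrf_vec_ray] at h3
  have hray : sqDispersion (t • dir θ) = rayDispersion (θ, t) := rfl
  rw [hray] at h3
  have h3' := abs_lt.mp h3
  -- `t` on the segment, in the closed square
  have h1' : |t| * |Real.cos θ| < π := by simpa [abs_mul] using h1
  have h2' : |t| * |Real.sin θ| < π := by simpa [abs_mul] using h2
  have hsq : ∀ i, |(t • dir θ) i| ≤ π := by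
    intro i
    fin_cases i
    · simpa [dir, smul_eq_mul, abs_mul] using h1'.le
    · simpa [dir, smul_eq_mul, abs_mul] using h2'.le
  have htI : t ∈ Icc 0 (π / ‖dir θ‖) := by
    refine ⟨ht.le, ?_⟩
    rw [le_div_iff₀ (norm_dir_pos θ), norm_dir]
    rw [abs_of_nonneg ht.le] at h1' h2'
    rcases le_total |Real.cos θ| |Real.sin θ| with hcs | hcs
    · rw [max_eq_right hcs]; exact h2'.le
    · rw [max_eq_left hcs]; exact h1'.le
  have htπ : t * ‖dir θ‖ ≤ π := by rw [← le_div_iff₀ (norm_dir_pos θ)]; exact htI.2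
  -- the free level of `t` lies in `[a, b]`
  have hδt := abs_le.mp (hδ _ hsq)
  have hat : a ≤ rayDispersion (θ, t) := by linarith [hδt.2]
  have htb : rayDispersion (θ, t) ≤ b := by linarith [hδt.1]
  -- the two end radii
  have hmlo : a ≤ μ - ē - κ₀ := hlo.le
  have hmhi : μ - ē + κ₀ ≤ b := by linarith
  have hplo : a ≤ μ + ē - κ₀ := by linarith
  have hphi : μ + ē + κ₀ ≤ b := hhi.le
  set um := perturbedFermiRadius δ (μ - ē) θ with hum
  set up := perturbedFermiRadius δ (μ + ē) θ with hup
  have hRm : IsBandFermiRadius (μ - ē - δ (um • dir θ)) θ um := isBandFermiRadius_perturbedFermiRadius B hδc hδ hmlo hmhi θ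
  have hRp : IsBandFermiRadius (μ + ē - δ (up • dir θ)) θ up := isBandFermiRadius_perturbedFermiRadius B hδc hδ hplo hphi θ
  have hmm := shiftedLevel_perturbedFermiRadius_mem_Icc B hδc hδ hmlo hmhi θ
  have hmp := shiftedLevel_perturbedFermiRadius_mem_Icc B hδc hδ hplo hphi θ
  have hDt : 0 < B.Dtmin - κ₁ := by linarith
  apply hnot
  constructor
  · -- `um < t`: else growth from `t` to `um` contradicts `G(t) > μ − ē = G(um)`
    by_contra hle
    push Not at hle
    have hg := klrf_growth B hδ1 hκ ht.le hle hRm.1.2 hat (by rw [hRm.2]; exact hmm.2)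
    rw [hRm.2] at hg
    nlinarith
  · by_contra hle
    push Not at hle
    have hg := klrf_growth B hδ1 hκ hRp.1.1 hle htπ (by rw [hRp.2]; exact hmp.1) htb
    rw [hRp.2] at hg
    nlinarith

include B hδ1 hδ hκ hκ₁ in
/-- **The planar integral over the perturbed band's tube in level coordinates (coarea on the frame's curve).**  `h : ℝ × ℝ → E` continuous
with compact support, supported in the open square `(−π,π)²` and in the tube `|ε₀ + δ − μ| < ē` (`0 ≤ ē`; margin window `a < μ − ē − κ₀`,
`μ + ē + κ₀ < b`).  Then
`∫ h = ∫_{θ ∈ (−π,π)} ∫_{e ∈ −ē..ē} (u_E(μ+e,θ)·(∂_tG(θ,u_E(μ+e,θ)))⁻¹) • h(u_E(μ+e,θ) cos θ, u_E(μ+e,θ) sin θ) de dθ`,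
`∂_tG(θ,t) = ∂_tε₀(θ,t) + Dδ(t·dir θ)[dir θ]`. -/
theorem klrf_integral_eq_frame_level_coords {E' : Type*} [NormedAddCommGroup E'] [NormedSpace ℝ E'] {h : ℝ × ℝ → E'}
    (hc : Continuous h) (hcs : HasCompactSupport h) {μ ē : ℝ} (hē : 0 ≤ ē) (hlo : a < μ - ē - κ₀) (hhi : μ + ē + κ₀ < b)
    (hsupp : ∀ p : ℝ × ℝ, h p ≠ 0 → |p.1| < π ∧ |p.2| < π ∧ |sqDispersion ![p.1, p.2] + δ ![p.1, p.2] - μ| < ē) :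
    ∫ p, h p = ∫ θ in Ioo (-π) π, ∫ e in (-ē)..ē,
      (perturbedFermiRadius δ (μ + e) θ *
          (rayDispersionDt θ (perturbedFermiRadius δ (μ + e) θ) +
            fderiv ℝ δ (perturbedFermiRadius δ (μ + e) θ • dir θ) (dir θ))⁻¹) •
        h (perturbedFermiRadius δ (μ + e) θ * Real.cos θ, perturbedFermiRadius δ (μ + e) θ * Real.sin θ) := by
  have hδc : Continuous δ := hδ1.continuous
  have hκ₀ : 0 ≤ κ₀ := (abs_nonneg _).trans (hδ 0 (fun i => by simp [Real.pi_pos.le]))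
  have hneg : μ + -ē = μ - ē := by ring
  refine klry_integral_eq_polar_ray hc hcs hē (ρ := fun θ e => perturbedFermiRadius δ (μ + e) θ)
    (ρₑ := fun θ e => (rayDispersionDt θ (perturbedFermiRadius δ (μ + e) θ) +
      fderiv ℝ δ (perturbedFermiRadius δ (μ + e) θ • dir θ) (dir θ))⁻¹) ?_ ?_ ?_ ?_ ?_
  · intro θ _ e he
    have hd := klrf_hasDerivAt_level B hδ1 hδ hκ hκ₁ (ν := μ + e) (by linarith [he.1]) (by linarith [he.2]) θ
    have h2' : HasDerivAt (fun e : ℝ => μ + e) 1 e := by simpa using (hasDerivAt_id e).const_add μ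
    have := hd.comp e h2'
    rw [mul_one] at this
    exact this
  · intro θ _
    exact klrf_continuousOn_invPertDt B hδ1 hδ hκ hκ₁ hlo hhi θ
  · intro θ _
    simp only [hneg]
    exact (perturbedFermiRadius_mem_Ioo B hδc hδ hlo.le (by linarith) θ).1
  · intro θ _
    simp only [hneg]
    exact (klrf_level_mono_growth B hδ1 hδ hκ hκ₁ hlo.le hhi.le (by linarith) θ).1
  · intro θ _ t ht hnot
    refine klrf_ray_support B hδ1 hδ hκ hκ₁ hlo hhi hsupp ht ?_
    simpa only [hneg] using hnot

include B hδ1 hδ hκ hκ₁ in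
/-- **Radial integrands on the frame's curve.**  If moreover `h(t cos θ, t sin θ) = H θ (ε₀(t·dir θ) + δ(t·dir θ) − μ)` for `t > 0`, then
`∫ h = ∫_{θ ∈ (−π,π)} ∫_{e ∈ −ē..ē} 𝒥_E(θ,e) • H θ e de dθ`, `𝒥_E(θ,e) = u_E(μ+e,θ)·(∂_tG(θ,u_E(μ+e,θ)))⁻¹` — the `(θ, e)` form consumed
by the `klte_*` / `klsp_*` estimates, now for the frame band `e_K = ε₀ − μ − K` (`δ = −K`). -/
theorem klrf_integral_eq_frame_level_coords_radial {E' : Type*} [NormedAddCommGroup E'] [NormedSpace ℝ E'] {h : ℝ × ℝ → E'}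
    (hc : Continuous h) (hcs : HasCompactSupport h) {μ ē : ℝ} (hē : 0 ≤ ē) (hlo : a < μ - ē - κ₀) (hhi : μ + ē + κ₀ < b)
    (hsupp : ∀ p : ℝ × ℝ, h p ≠ 0 → |p.1| < π ∧ |p.2| < π ∧ |sqDispersion ![p.1, p.2] + δ ![p.1, p.2] - μ| < ē)
    {H : ℝ → ℝ → E'}
    (hfac : ∀ θ ∈ Ioo (-π) π, ∀ t, 0 < t → h (t * Real.cos θ, t * Real.sin θ) = H θ (rayDispersion (θ, t) + δ (t • dir θ) - μ)) :
    ∫ p, h p = ∫ θ in Ioo (-π) π, ∫ e in (-ē)..ē,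
      (perturbedFermiRadius δ (μ + e) θ *
          (rayDispersionDt θ (perturbedFermiRadius δ (μ + e) θ) +
            fderiv ℝ δ (perturbedFermiRadius δ (μ + e) θ • dir θ) (dir θ))⁻¹) • H θ e := by
  have hδc : Continuous δ := hδ1.continuous
  have hκ₀ : 0 ≤ κ₀ := (abs_nonneg _).trans (hδ 0 (fun i => by simp [Real.pi_pos.le]))
  have hneg : μ + -ē = μ - ē := by ring
  refine klry_integral_eq_polar_ray_level hc hcs hē (ρ := fun θ e => perturbedFermiRadius δ (μ + e) θ)
    (ρₑ := fun θ e => (rayDispersionDt θ (perturbedFermiRadius δ (μ + e) θ) +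
      fderiv ℝ δ (perturbedFermiRadius δ (μ + e) θ • dir θ) (dir θ))⁻¹)
    (eOf := fun θ t => rayDispersion (θ, t) + δ (t • dir θ) - μ) (H := H) ?_ ?_ ?_ ?_ ?_ hfac ?_
  · intro θ _ e he
    have hd := klrf_hasDerivAt_level B hδ1 hδ hκ hκ₁ (ν := μ + e) (by linarith [he.1]) (by linarith [he.2]) θ
    have h2' : HasDerivAt (fun e : ℝ => μ + e) 1 e := by simpa using (hasDerivAt_id e).const_add μ
    have := hd.comp e h2'
    rw [mul_one] at this
    exact this
  · intro θ _
    exact klrf_continuousOn_invPertDt B hδ1 hδ hκ hκ₁ hlo hhi θ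
  · intro θ _ e he
    exact (perturbedFermiRadius_mem_Ioo B hδc hδ (μ := μ + e) (by linarith [he.1]) (by linarith [he.2]) θ).1
  · intro θ _
    simp only [hneg]
    exact (klrf_level_mono_growth B hδ1 hδ hκ hκ₁ hlo.le hhi.le (by linarith) θ).1
  · intro θ _ t ht hnot
    refine klrf_ray_support B hδ1 hδ hκ hκ₁ hlo hhi hsupp ht ?_
    simpa only [hneg] using hnot
  · intro θ _ e he
    show rayDispersion (θ, perturbedFermiRadius δ (μ + e) θ) + δ (perturbedFermiRadius δ (μ + e) θ • dir θ) - μ = e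
    have := (isBandFermiRadius_perturbedFermiRadius B hδc hδ (μ := μ + e) (by linarith [he.1]) (by linarith [he.2]) θ).2
    linarith

end Frame

end Summit.HubbardSuperconductivity.HubbardSuperconductivity.Theorems.KLRegimeSplit

end
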